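import Summits.CriticalPhenomena.SAWScalingLimit.Theses.SAWPoincareChain
import Summits.CriticalPhenomena.SAWScalingLimit.Theorems.SAWRenewalTightnessTightIdentificationGlue

/-!
# Route `SAWPoincareChain`: the assembly frame `Assembly` (stmt-CriticalPhenomena-7561)

`Assembly := DiscRestrictionIsSLE → DiscToDomains → ChainLaw → SubCurvatureTightness →
ObstacleIsMetric → LatticeJoinsChain → SAWScalingLimit`.

Bookkeeping over proved tree facts, exactly as the route's `## Assembly` paragraph says. Take the
chordal family `Q` of `ChainLaw`; only two of its eventual properties are used — `Q t` is chordal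
and exactly conformally covariant for all small `t > 0` — the approximant clause is merely handed
on to the three `∀ Q, …` cruxes. Then:

1. (disc) every probability subsequential weak limit `μ` of the disc laws `Q t (𝔻; 1, −1)` along
   `t → 0⁺` is carried by chordal classes (closed event of full `Q t 𝔻`-mass for small `t`;
   closed half of the portmanteau theorem, `ae_mem_of_isClosed_of_isSubseqLimitLaw`), is invariant
   under every disc automorphism fixing `±1` pushed along a continuous extension (exact covariance
   of `Q t` at each small `t`, continuity of `CurveClass.map Φ`, uniqueness of weak limits:
   `map_eq_of_isSubseqLimitLaw`), has hull restriction (`ObstacleIsMetric`) and is carried by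
   simple curves touching the circle only at `±1` (`SubCurvatureTightness`); so
   `DiscRestrictionIsSLE` identifies it as the chordal SLE_{8/3} law of the disc, and the tree's
   PROVED Prokhorov/Billingsley criterion for eventually-probability laws
   (`convergesInLawToSLE_of_isTightAlongMesh_of_eventually`, uniqueness of the SLE law
   `IsSLECurve.map_eq_holds` inside) upgrades tightness (`SubCurvatureTightness`) to convergence
   in law of `Q t 𝔻` as `t → 0⁺` (`exists_isSLELaw_tendstoLaw_unitDisc`);
2. (domains) `DiscToDomains` transports the convergence to every Dobrushin domain `D`;
3. (lattice) `LatticeJoinsChain` gives a schedule `e(δ) → 0⁺` along which the critical `δℤ²` SAW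
   law and `Q (e δ) D` are asymptotically equal on bounded continuous test functions; composing
   limits and unfolding `IsSLELaw` (`∃ Γ, IsSLECurve ∧ ν = law Γ`, `integral_map`) gives
   `ConvergesInLawToSLE (8/3) D` of the SAW curve observable (measurable: discrete σ-algebra,
   `SAW.aemeasurable_curve`), i.e. `SAWScalingLimit` (`saw_convergesInLawToSLE_of_asymp`).

No new definitions; no named-fact hypotheses.

## References

* P. Billingsley, *Convergence of Probability Measures*, 2nd ed. (1999), Thm. 2.1 (portmanteau)
  and Thm. 5.1 with its Corollary [BillingsleyCPM1999].
* G. F. Lawler, O. Schramm, W. Werner, *Conformal restriction: the chordal case*, JAMS 16 (2003)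
  [LawlerSchrammWerner2003Restriction]; *On the scaling limit of planar self-avoiding walk* (2004),
  §3.4.2 and Prediction 1 [LawlerSchrammWerner2004SAW].
-/

noncomputable section

open MeasureTheory Filter Topology Set
open scoped NNReal ENNReal BoundedContinuousFunction
open Literature.Probability.RandomPlanarGeometry Literature.Probability.LatticeModels

namespace Summit.CriticalPhenomena.SAWScalingLimit.Theorems

/-! ### Two facts about subsequential weak limits of laws on a metric space -/

section SubseqLimits

variable {X : Type*} [MetricSpace X] [MeasurableSpace X] [BorelSpace X]

/-- **Sure closed events pass to subsequential limits** (closed half of the portmanteau theorem).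
Let `P t` be laws on a metric space, probability measures for all small `t > 0`, and `μ` a
probability subsequential weak limit law of the identity observable along `t → 0⁺`. If a closed
set `F` has full `P t`-mass for all small `t`, then it has full `μ`-mass:
`limsup P(s n)(F) ≤ μ(F)` (Mathlib's `ProbabilityMeasure.limsup_measure_closed_le_of_tendsto`,
applied to the surrogate sequence which replaces the finitely many non-probability laws by `μ`).
[cite: BillingsleyCPM1999, Thm. 2.1 (portmanteau, closed sets)] -/
theorem ae_mem_of_isClosed_of_isSubseqLimitLaw {P : ℝ → Measure X} {μ : Measure X}
    [IsProbabilityMeasure μ] (hP : ∀ᶠ t in 𝓝[>] (0 : ℝ), IsProbabilityMeasure (P t))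
    (h : IsSubseqLimitLaw (fun (_ : ℝ) (x : X) => x) P μ) {F : Set X} (hF : IsClosed F)
    (hPF : ∀ᶠ t in 𝓝[>] (0 : ℝ), ∀ᵐ x ∂(P t), x ∈ F) : ∀ᵐ x ∂μ, x ∈ F := by
  classical
  obtain ⟨s, hs, hlim⟩ := h
  -- surrogate sequence of probability measures, equal to `P (s n)` for all large `n`
  let ν : ℕ → ProbabilityMeasure X := fun n =>
    if hn : IsProbabilityMeasure (P (s n)) then ⟨P (s n), hn⟩ else ⟨μ, inferInstance⟩
  have hν : ∀ᶠ n in atTop, (ν n : Measure X) = P (s n) := by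
    filter_upwards [hs.eventually hP] with n hn
    simp only [ν, dif_pos hn]
    rfl
  have hT : Tendsto ν atTop (𝓝 ⟨μ, inferInstance⟩) := by
    rw [ProbabilityMeasure.tendsto_iff_forall_integral_tendsto]
    intro f
    refine (hlim f).congr' ?_
    filter_upwards [hν] with n hn
    rw [hn]
  have hle := ProbabilityMeasure.limsup_measure_closed_le_of_tendsto hT hF
  have h1 : ∀ᶠ n in atTop, (ν n : Measure X) F = (1 : ℝ≥0∞) := by
    filter_upwards [hν, hs.eventually hPF, hs.eventually hP] with n hn hnF hnP
    rw [hn]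
    haveI := hnP
    exact (prob_compl_eq_zero_iff hF.measurableSet).1 (mem_ae_iff.1 hnF)
  have hlimsup : atTop.limsup (fun n => (ν n : Measure X) F) = 1 := by
    rw [limsup_congr h1, limsup_const]
  rw [hlimsup] at hle
  have hμF : μ F = 1 := le_antisymm prob_le_one hle
  exact mem_ae_iff.2 ((prob_compl_eq_zero_iff hF.measurableSet).2 hμF)

/-- **Subsequential limits inherit invariance under a continuous map.** If `μ` (finite) is a
subsequential weak limit law of the laws `P t` (identity observable) along `t → 0⁺`, `F : X → X`
is continuous and `F_* (P t) = P t` for all small `t > 0`, then `F_* μ = μ`: for bounded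
continuous `f`, `∫ f d(F_* μ) = ∫ f ∘ F dμ = lim ∫ f ∘ F dP(s n) = lim ∫ f dP(s n) = ∫ f dμ`, and
finite Borel measures on a metric space are determined by such integrals
(`ext_of_forall_integral_eq_of_IsFiniteMeasure`). [cite: BillingsleyCPM1999, Thm. 1.2 and §2 (mapping theorem)] -/
theorem map_eq_of_isSubseqLimitLaw {P : ℝ → Measure X} {μ : Measure X} [IsFiniteMeasure μ]
    (h : IsSubseqLimitLaw (fun (_ : ℝ) (x : X) => x) P μ) {F : X → X} (hF : Continuous F)
    (hinv : ∀ᶠ t in 𝓝[>] (0 : ℝ), (P t).map F = P t) : μ.map F = μ := by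
  obtain ⟨s, hs, hlim⟩ := h
  refine ext_of_forall_integral_eq_of_IsFiniteMeasure fun f => ?_
  rw [integral_map hF.measurable.aemeasurable f.continuous.aestronglyMeasurable]
  have h1 : Tendsto (fun n => ∫ x, (f.compContinuous ⟨F, hF⟩) x ∂P (s n)) atTop
      (𝓝 (∫ x, (f.compContinuous ⟨F, hF⟩) x ∂μ)) := hlim _
  have h2 : Tendsto (fun n => ∫ x, f x ∂P (s n)) atTop (𝓝 (∫ x, f x ∂μ)) := hlim f
  have h3 : ∀ᶠ n in atTop,
      ∫ x, (f.compContinuous ⟨F, hF⟩) x ∂P (s n) = ∫ x, f x ∂P (s n) := by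
    filter_upwards [hs.eventually hinv] with n hn
    conv_rhs => rw [← hn]
    rw [integral_map hF.measurable.aemeasurable f.continuous.aestronglyMeasurable]
    rfl
  exact tendsto_nhds_unique (h1.congr' h3) h2

end SubseqLimits

/-! ### The disc: subsequential limits are the SLE(8/3) law, hence convergence -/

open Summit.CriticalPhenomena.SAWScalingLimit.Theses.SAWPoincareChain

/-- **Step 1 (disc).** For an eventually chordal, eventually exactly conformally covariant family
`Q`, whose disc laws are tight along `t → 0⁺` and whose probability subsequential limits have hull
restriction with transport (the conclusion of `ObstacleIsMetric`) and are carried by simple curves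
touching the circle only at `±1` (the conclusion of `SubCurvatureTightness`), and given the
identification `DiscRestrictionIsSLE`: the disc laws `Q t (𝔻; 1, −1)` converge weakly as `t → 0⁺`
to an SLE_{8/3} law of the disc. The two remaining hypotheses of `DiscRestrictionIsSLE` are
supplied here: chordality of the limit (portmanteau, closed sets) and invariance under the
stabiliser of `(𝔻; 1, −1)` (exact covariance at each small `t` passes to weak limits); then the
Prokhorov/Billingsley criterion `convergesInLawToSLE_of_isTightAlongMesh_of_eventually`.
[cite: BillingsleyCPM1999, Thm. 5.1, Corollary] -/
theorem exists_isSLELaw_tendstoLaw_unitDisc (hDR : DiscRestrictionIsSLE)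
    (Q : ℝ → ChordalFamily)
    (hQ : ∀ᶠ t in 𝓝[>] (0 : ℝ), (Q t).IsChordal ∧ (Q t).IsConformallyCovariant)
    (hTight : IsTightAlongMesh (fun (_ : ℝ) (x : CurveClass ℂ) => x)
      (fun t => Q t DobrushinDomain.unitDisc))
    (hSimple : ∀ μ : Measure (CurveClass ℂ), IsProbabilityMeasure μ →
      IsSubseqLimitLaw (fun (_ : ℝ) (x : CurveClass ℂ) => x)
        (fun t => Q t DobrushinDomain.unitDisc) μ →
      ∀ᵐ γ ∂μ, γ ∈ CurveClass.simple ∧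
        γ.range ∩ frontier DobrushinDomain.unitDisc.carrier ⊆
          {DobrushinDomain.unitDisc.pt 0, DobrushinDomain.unitDisc.pt 1})
    (hRestr : ∀ μ : Measure (CurveClass ℂ), IsProbabilityMeasure μ →
      IsSubseqLimitLaw (fun (_ : ℝ) (x : CurveClass ℂ) => x)
        (fun t => Q t DobrushinDomain.unitDisc) μ →
      ∀ U : DobrushinDomain, MarkedDomain.IsHullSubdomain DobrushinDomain.unitDisc U →
      ∀ (g : ConformalEquiv DobrushinDomain.unitDisc.carrier U.carrier) (Φ : C(ℂ, ℂ)),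
        g.HasBoundaryValue (DobrushinDomain.unitDisc.pt 0) (DobrushinDomain.unitDisc.pt 0) →
        g.HasBoundaryValue (DobrushinDomain.unitDisc.pt 1) (DobrushinDomain.unitDisc.pt 1) →
        Set.EqOn Φ g DobrushinDomain.unitDisc.carrier →
        ∀ T : Set (CurveClass ℂ), MeasurableSet T →
          μ.map (CurveClass.map Φ) T * μ (CurveClass.rangeSubset (closure U.carrier)) =
            μ (T ∩ CurveClass.rangeSubset (closure U.carrier))) :
    ∃ μ : Measure (CurveClass ℂ), IsSLELaw ((8 : ℝ≥0) / 3) DobrushinDomain.unitDisc μ ∧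
      TendstoLaw (fun (_ : ℝ) (x : CurveClass ℂ) => x)
        (fun t => Q t DobrushinDomain.unitDisc) id μ := by
  have hP : ∀ᶠ t in 𝓝[>] (0 : ℝ), IsProbabilityMeasure (Q t DobrushinDomain.unitDisc) :=
    hQ.mono fun t ht => (ht.1 DobrushinDomain.unitDisc).1
  have key : ConvergesInLawToSLE ((8 : ℝ≥0) / 3) DobrushinDomain.unitDisc
      (Ωδ := fun _ : ℝ => CurveClass ℂ) (fun (_ : ℝ) (x : CurveClass ℂ) => x)
      (fun t => Q t DobrushinDomain.unitDisc) := by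
    refine convergesInLawToSLE_of_isTightAlongMesh_of_eventually hP
      (Eventually.of_forall fun _ => aemeasurable_id') hTight fun μ hμ hsub => ?_
    refine hDR μ hμ ?_ ?_ (hRestr μ hμ hsub) (hSimple μ hμ hsub)
    · -- chordal carrier: a sure closed event for all small `t`
      -- (the event is closed: endpoints are continuous functionals, staying in a closed set is
      -- a closed event)
      exact ae_mem_of_isClosed_of_isSubseqLimitLaw
        (F := {γ : CurveClass ℂ | γ.source = DobrushinDomain.unitDisc.pt 0 ∧
          γ.target = DobrushinDomain.unitDisc.pt 1 ∧
          γ.range ⊆ closure DobrushinDomain.unitDisc.carrier}) hP hsub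
        ((isClosed_eq CurveClass.continuous_source continuous_const).inter
          ((isClosed_eq CurveClass.continuous_target continuous_const).inter
            (CurveClass.isClosed_rangeSubset isClosed_closure)))
        (hQ.mono fun t ht => (ht.1 DobrushinDomain.unitDisc).2)
    · -- invariance under the stabiliser of `(𝔻; 1, -1)`
      intro g Φ h0 h1 hΦ
      refine map_eq_of_isSubseqLimitLaw hsub (CurveClass.continuous_map Φ) ?_
      filter_upwards [hQ] with t ht
      exact (ht.2 DobrushinDomain.unitDisc DobrushinDomain.unitDisc g Φ h0 h1 hΦ).symm
  obtain ⟨Γ, hΓ, -, hlaw⟩ := key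
  refine ⟨_, hΓ.isSLELaw_map, fun f => ?_⟩
  have h := hlaw f
  rw [← integral_map hΓ.aemeasurable f.continuous.aestronglyMeasurable] at h
  exact h

/-! ### From the chain law in `D` to the SAW law in `D` -/

/-- **Step 3 (lattice).** If `ν` is an SLE_{8/3} law of `D`, the laws `R t` converge weakly to `ν`
as `t → 0⁺`, and along a schedule `e(δ) → 0⁺` the critical `δℤ²` SAW law (pushed to curves) and
`R (e δ)` are asymptotically equal on bounded continuous test functions, then the SAW converges in
law to chordal SLE_{8/3} in `D` (`ConvergesInLawToSLE`): composition of limits, `IsSLELaw` unfolded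
to an SLE random curve `Γ` with `ν = law Γ` and `integral_map`; measurability of the curve
observable is automatic (`SAW.aemeasurable_curve`). [cite: LawlerSchrammWerner2004SAW, §3.4.2] -/
theorem saw_convergesInLawToSLE_of_asymp {D : DobrushinDomain} {a b : ℝ → Site 2}
    {ν : Measure (CurveClass ℂ)} (hν : IsSLELaw ((8 : ℝ≥0) / 3) D ν)
    {R : ℝ → Measure (CurveClass ℂ)}
    (hR : TendstoLaw (fun (_ : ℝ) (x : CurveClass ℂ) => x) R id ν)
    {e : ℝ → ℝ} (he : Tendsto e (𝓝[>] (0 : ℝ)) (𝓝[>] (0 : ℝ)))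
    (hf : ∀ f : CurveClass ℂ →ᵇ ℝ, Tendsto
      (fun δ => (∫ γ, f γ.curve ∂(SAW.law D.carrier δ (a δ) (b δ))) - ∫ x, f x ∂(R (e δ)))
      (𝓝[>] (0 : ℝ)) (𝓝 0)) :
    ConvergesInLawToSLE ((8 : ℝ≥0) / 3) D
      (fun δ (γ : SAW.DomainSAW D.carrier δ (a δ) (b δ)) => γ.curve)
      (fun δ => SAW.law D.carrier δ (a δ) (b δ)) := by
  obtain ⟨Γ, hΓ, rfl⟩ := hν
  refine ⟨Γ, hΓ, Eventually.of_forall fun δ => SAW.aemeasurable_curve D.carrier δ (a δ) (b δ),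
    fun f => ?_⟩
  have h1 : Tendsto (fun δ => ∫ x, f x ∂(R (e δ))) (𝓝[>] (0 : ℝ))
      (𝓝 (∫ ω, f (Γ ω) ∂Literature.Probability.Process.preWienerMeasure)) := by
    have h := (hR f).comp he
    rw [← integral_map hΓ.aemeasurable f.continuous.aestronglyMeasurable]
    exact h
  have h2 := (hf f).add h1
  simp only [sub_add_cancel, zero_add] at h2
  exact h2

/-! ### The core and the item -/

/-- **The assembly, core form.** From `DiscRestrictionIsSLE`, `DiscToDomains`, a family `Q` which
is eventually chordal and exactly conformally covariant, tightness of its disc laws, the two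
conclusions of `SubCurvatureTightness`/`ObstacleIsMetric` for `Q`, and the conclusion of
`LatticeJoinsChain` for `Q`: the conjunct `SAWScalingLimit`. Steps 1–3 of the module docstring.
[cite: BillingsleyCPM1999, Thm. 5.1, Corollary] -/
theorem sawPoincareChain_assembly_core (hDR : DiscRestrictionIsSLE) (hDD : DiscToDomains)
    (Q : ℝ → ChordalFamily)
    (hQ : ∀ᶠ t in 𝓝[>] (0 : ℝ), (Q t).IsChordal ∧ (Q t).IsConformallyCovariant)
    (hTight : IsTightAlongMesh (fun (_ : ℝ) (x : CurveClass ℂ) => x)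
      (fun t => Q t DobrushinDomain.unitDisc))
    (hSimple : ∀ μ : Measure (CurveClass ℂ), IsProbabilityMeasure μ →
      IsSubseqLimitLaw (fun (_ : ℝ) (x : CurveClass ℂ) => x)
        (fun t => Q t DobrushinDomain.unitDisc) μ →
      ∀ᵐ γ ∂μ, γ ∈ CurveClass.simple ∧
        γ.range ∩ frontier DobrushinDomain.unitDisc.carrier ⊆
          {DobrushinDomain.unitDisc.pt 0, DobrushinDomain.unitDisc.pt 1})
    (hRestr : ∀ μ : Measure (CurveClass ℂ), IsProbabilityMeasure μ →
      IsSubseqLimitLaw (fun (_ : ℝ) (x : CurveClass ℂ) => x)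
        (fun t => Q t DobrushinDomain.unitDisc) μ →
      ∀ U : DobrushinDomain, MarkedDomain.IsHullSubdomain DobrushinDomain.unitDisc U →
      ∀ (g : ConformalEquiv DobrushinDomain.unitDisc.carrier U.carrier) (Φ : C(ℂ, ℂ)),
        g.HasBoundaryValue (DobrushinDomain.unitDisc.pt 0) (DobrushinDomain.unitDisc.pt 0) →
        g.HasBoundaryValue (DobrushinDomain.unitDisc.pt 1) (DobrushinDomain.unitDisc.pt 1) →
        Set.EqOn Φ g DobrushinDomain.unitDisc.carrier →
        ∀ T : Set (CurveClass ℂ), MeasurableSet T →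
          μ.map (CurveClass.map Φ) T * μ (CurveClass.rangeSubset (closure U.carrier)) =
            μ (T ∩ CurveClass.rangeSubset (closure U.carrier)))
    (hJoin : ∀ (D : DobrushinDomain) (a b : ℝ → Site 2), SAW.IsEndpointApprox D a b →
      ∃ e : ℝ → ℝ, Tendsto e (𝓝[>] (0 : ℝ)) (𝓝[>] (0 : ℝ)) ∧
        ∀ f : CurveClass ℂ →ᵇ ℝ, Tendsto
          (fun δ => (∫ γ, f γ.curve ∂(SAW.law D.carrier δ (a δ) (b δ))) - ∫ x, f x ∂(Q (e δ) D))
          (𝓝[>] (0 : ℝ)) (𝓝 0)) :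
    SAW.SAWScalingLimit := by
  intro D a b hab
  have hdisc := exists_isSLELaw_tendstoLaw_unitDisc hDR Q hQ hTight hSimple hRestr
  obtain ⟨ν, hν, hR⟩ := hDD Q hQ hdisc D
  obtain ⟨e, he, hf⟩ := hJoin D a b hab
  exact saw_convergesInLawToSLE_of_asymp hν hR he hf

/-- **Item `stmt-CriticalPhenomena-7561` (`SAWPoincareChain.Assembly`):
`DiscRestrictionIsSLE → DiscToDomains → ChainLaw → SubCurvatureTightness → ObstacleIsMetric →
LatticeJoinsChain → SAWScalingLimit`.** Take `Q` from `ChainLaw`, feed its defining eventual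
property to the three `∀ Q` cruxes, and apply `sawPoincareChain_assembly_core`.
[cite: BillingsleyCPM1999, Thm. 5.1, Corollary] -/
theorem sawPoincareChain_assembly_proof : Assembly := by
  intro hDR hDD hCL hT hOM hLJ
  obtain ⟨Q, hQ⟩ := hCL
  exact sawPoincareChain_assembly_core hDR hDD Q (hQ.mono fun t ht => ⟨ht.1, ht.2.1⟩)
    (hT Q hQ).1 (hT Q hQ).2 (hOM Q hQ) (hLJ Q hQ)

end Summit.CriticalPhenomena.SAWScalingLimit.Theorems

end
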